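import Mathlib.Analysis.SpecialFunctions.PolarCoord
import Mathlib.MeasureTheory.Measure.Lebesgue.EqHaar
import HarnessLib

/-!
# Two measure-theoretic lemmas for the defect function: wedges of the plane, sections of even sets

Elementary Lebesgue-measure bookkeeping used in the computation of Lovas–Andai's defect
function `χ₁` (2017, Lemma 6, Appendix A), isolated from the specific body:

* `volume_eq_two_mul_wedge_add` : for a measurable `S ⊆ ℝ²` invariant under `x ↦ −x`,
  `λ₂(S) = 2 λ₂(S ∩ W) + 2 λ₂(swap⁻¹ S ∩ W)` with the open wedge `W = {(q, s) | |q| < s}`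
  (the plane is the union of the four wedges `±W`, `±swap W` and the null cone `|q| = |s|`) —
  the four charts `X_±`, `X_± σ₃` of Lovas–Andai's atlas;
* `volume_setOf_le_and_le_sub` : for `g : ℝ → ℝ` even and monotone on `[0, ∞)` and `δ ≥ 0`,
  `λ₁{τ | g τ ≤ c ∧ g (τ − δ) ≤ c} = 2 λ₁((δ/2, ∞) ∩ {g ≤ c})` — the `t`-section of the
  intersection of the body with its translate ("`‖Y(t−δ)‖ > ‖Y(t)‖` iff `t < δ/2`" in
  Appendix A).

## References

* [LovasAndai2017] A. Lovas, A. Andai, Invariance of separability probability over reduced states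
  in 4 × 4 bipartite systems, J. Phys. A 50 (2017) 295303, Appendix A.
-/

noncomputable section

open MeasureTheory Set Real
open scoped ENNReal

namespace Literature.InformationTheory.Entanglement

/-! ### The wedge decomposition of the plane -/

/-- The open upper wedge `W = {(q, s) | |q| < s}`. [folklore] -/
def planeWedge : Set (ℝ × ℝ) := {x | |x.1| < x.2}

/-- `W` is measurable. [folklore] -/
theorem measurableSet_planeWedge : MeasurableSet planeWedge :=
  (isOpen_lt (by fun_prop) continuous_snd).measurableSet

/-- Negation of the plane as a linear map has determinant `1`. [folklore] -/
theorem det_neg_id_plane : LinearMap.det (-LinearMap.id : ℝ × ℝ →ₗ[ℝ] ℝ × ℝ) = 1 := by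
  have h : (-LinearMap.id : ℝ × ℝ →ₗ[ℝ] ℝ × ℝ) = (-1 : ℝ) • LinearMap.id :=
    (neg_one_smul ℝ _).symm
  rw [h, LinearMap.det_smul, LinearMap.det_id, Module.finrank_prod, Module.finrank_self]
  norm_num

/-- Lebesgue measure on the plane is invariant under `x ↦ −x`. [folklore] -/
theorem volume_preimage_neg_plane (S : Set (ℝ × ℝ)) :
    volume ((fun x : ℝ × ℝ => -x) ⁻¹' S) = volume S := by
  have h := Measure.addHaar_preimage_linearMap (volume : Measure (ℝ × ℝ))
    (f := (-LinearMap.id : ℝ × ℝ →ₗ[ℝ] ℝ × ℝ)) (by rw [det_neg_id_plane]; exact one_ne_zero) S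
  rw [det_neg_id_plane, inv_one, abs_one, ENNReal.ofReal_one, one_mul] at h
  exact h

/-- Lebesgue measure on the plane is invariant under the coordinate swap. [folklore] -/
theorem volume_preimage_swap_plane (S : Set (ℝ × ℝ)) :
    volume (Prod.swap ⁻¹' S) = volume S := by
  have h : Measure.map Prod.swap (volume : Measure (ℝ × ℝ)) = volume := by
    rw [Measure.volume_eq_prod, Measure.prod_swap]
  have h2 := MeasurableEquiv.map_apply (μ := (volume : Measure (ℝ × ℝ)))
    (MeasurableEquiv.prodComm (α := ℝ) (β := ℝ)) S
  change Measure.map Prod.swap volume S = volume (Prod.swap ⁻¹' S) at h2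
  rw [← h2, h]

/-- The null cone `{|q| = |s|}` has measure zero. [folklore] -/
theorem volume_cone_eq_zero : volume {x : ℝ × ℝ | |x.1| = |x.2|} = 0 := by
  have hsub : {x : ℝ × ℝ | |x.1| = |x.2|} ⊆
      (LinearMap.ker (LinearMap.fst ℝ ℝ ℝ - LinearMap.snd ℝ ℝ ℝ) : Set (ℝ × ℝ)) ∪
        (LinearMap.ker (LinearMap.fst ℝ ℝ ℝ + LinearMap.snd ℝ ℝ ℝ) : Set (ℝ × ℝ)) := by
    intro x hx
    simp only [mem_setOf_eq] at hx
    rcases abs_eq_abs.1 hx with h | h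
    · left
      simp [h]
    · right
      simp [h]
  have h1 : volume (LinearMap.ker (LinearMap.fst ℝ ℝ ℝ - LinearMap.snd ℝ ℝ ℝ) : Set (ℝ × ℝ)) = 0 := by
    apply Measure.addHaar_submodule
    rw [Ne, LinearMap.ker_eq_top]
    intro h
    have := LinearMap.congr_fun h (1, 0)
    simp at this
  have h2 : volume (LinearMap.ker (LinearMap.fst ℝ ℝ ℝ + LinearMap.snd ℝ ℝ ℝ) : Set (ℝ × ℝ)) = 0 := by
    apply Measure.addHaar_submodule
    rw [Ne, LinearMap.ker_eq_top]
    intro h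
    have := LinearMap.congr_fun h (1, 0)
    simp at this
  exact measure_mono_null hsub (measure_union_null h1 h2)

/-- **The wedge decomposition**: for any `S ⊆ ℝ²`,
`λ₂(S) = λ₂(S ∩ W) + λ₂(S ∩ (−W)) + λ₂(S ∩ swap⁻¹(W ∪ −W))`. [folklore] -/
theorem volume_eq_sum_wedges (S : Set (ℝ × ℝ)) :
    volume S = volume (S ∩ planeWedge) + volume (S ∩ (fun x : ℝ × ℝ => -x) ⁻¹' planeWedge) +
      volume (S ∩ Prod.swap ⁻¹' (planeWedge ∪ (fun x : ℝ × ℝ => -x) ⁻¹' planeWedge)) := by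
  have hW := measurableSet_planeWedge
  have hnW : MeasurableSet ((fun x : ℝ × ℝ => -x) ⁻¹' planeWedge) := hW.preimage measurable_neg
  have hsW : MeasurableSet (Prod.swap ⁻¹' (planeWedge ∪ (fun x : ℝ × ℝ => -x) ⁻¹' planeWedge)) :=
    (hW.union hnW).preimage measurable_swap
  -- peel off the three pieces
  have e1 := measure_inter_add_sdiff (μ := (volume : Measure (ℝ × ℝ))) S hW
  have e2 := measure_inter_add_sdiff (μ := (volume : Measure (ℝ × ℝ))) (S \ planeWedge) hnW
  have e3 := measure_inter_add_sdiff (μ := (volume : Measure (ℝ × ℝ)))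
    ((S \ planeWedge) \ (fun x : ℝ × ℝ => -x) ⁻¹' planeWedge) hsW
  have i2 : (S \ planeWedge) ∩ (fun x : ℝ × ℝ => -x) ⁻¹' planeWedge =
      S ∩ (fun x : ℝ × ℝ => -x) ⁻¹' planeWedge := by
    ext x
    simp only [mem_inter_iff, mem_sdiff, mem_preimage, planeWedge, mem_setOf_eq, Prod.fst_neg,
      Prod.snd_neg, abs_neg]
    constructor
    · rintro ⟨⟨h1, -⟩, h2⟩; exact ⟨h1, h2⟩
    · rintro ⟨h1, h2⟩
      refine ⟨⟨h1, fun h3 => ?_⟩, h2⟩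
      have := abs_nonneg x.1
      linarith
  have i3 : ((S \ planeWedge) \ (fun x : ℝ × ℝ => -x) ⁻¹' planeWedge) ∩
      Prod.swap ⁻¹' (planeWedge ∪ (fun x : ℝ × ℝ => -x) ⁻¹' planeWedge) =
      S ∩ Prod.swap ⁻¹' (planeWedge ∪ (fun x : ℝ × ℝ => -x) ⁻¹' planeWedge) := by
    ext x
    simp only [mem_inter_iff, mem_sdiff, mem_preimage, mem_union, planeWedge, mem_setOf_eq,
      Prod.fst_neg, Prod.snd_neg, abs_neg, Prod.fst_swap, Prod.snd_swap]
    constructor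
    · rintro ⟨⟨⟨h1, -⟩, -⟩, h2⟩; exact ⟨h1, h2⟩
    · rintro ⟨h1, h2⟩
      have hlt : |x.2| < |x.1| := by
        rcases h2 with h | h
        · exact lt_of_lt_of_le h (le_abs_self _)
        · exact lt_of_lt_of_le h (neg_le_abs _)
      refine ⟨⟨⟨h1, fun h3 => ?_⟩, fun h3 => ?_⟩, h2⟩
      · have := lt_of_lt_of_le h3 (le_abs_self x.2); linarith
      · have := lt_of_lt_of_le h3 (neg_le_abs x.2); linarith
  have i4 : ((S \ planeWedge) \ (fun x : ℝ × ℝ => -x) ⁻¹' planeWedge) \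
      Prod.swap ⁻¹' (planeWedge ∪ (fun x : ℝ × ℝ => -x) ⁻¹' planeWedge) ⊆
      {x : ℝ × ℝ | |x.1| = |x.2|} := by
    intro x hx
    simp only [mem_sdiff, mem_preimage, mem_union, planeWedge, mem_setOf_eq, Prod.fst_neg,
      Prod.snd_neg, abs_neg, Prod.fst_swap, Prod.snd_swap, not_or, not_lt] at hx
    obtain ⟨⟨⟨-, h1⟩, h2⟩, h3, h4⟩ := hx
    simp only [mem_setOf_eq]
    have ha : |x.2| ≤ |x.1| := abs_le.2 ⟨by linarith, by
      rcases le_or_gt 0 x.2 with h | h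
      · rw [abs_of_nonneg h] at *; linarith [h1]
      · rw [abs_of_neg h] at *; linarith [h2]⟩
    have hb : |x.1| ≤ |x.2| := abs_le.2 ⟨by linarith, by
      rcases le_or_gt 0 x.1 with h | h
      · linarith [h3, abs_of_nonneg h]
      · linarith [h4, abs_of_neg h]⟩
    exact le_antisymm hb ha
  have z4 : volume (((S \ planeWedge) \ (fun x : ℝ × ℝ => -x) ⁻¹' planeWedge) \
      Prod.swap ⁻¹' (planeWedge ∪ (fun x : ℝ × ℝ => -x) ⁻¹' planeWedge)) = 0 :=
    measure_mono_null i4 volume_cone_eq_zero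
  rw [i2] at e2
  rw [i3, z4, add_zero] at e3
  rw [← e1, ← e2, ← e3, add_assoc]

/-- **The wedge decomposition for a centrally symmetric set**: for a measurable `S ⊆ ℝ²` with
`−S = S`, `λ₂(S) = 2 λ₂(S ∩ W) + 2 λ₂(swap⁻¹ S ∩ W)`. [folklore] -/
theorem volume_eq_two_mul_wedge_add {S : Set (ℝ × ℝ)} (hS : MeasurableSet S)
    (hneg : (fun x : ℝ × ℝ => -x) ⁻¹' S = S) :
    volume S = 2 * volume (S ∩ planeWedge) + 2 * volume (Prod.swap ⁻¹' S ∩ planeWedge) := by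
  have hW := measurableSet_planeWedge
  rw [volume_eq_sum_wedges S]
  -- the second wedge
  have h2 : volume (S ∩ (fun x : ℝ × ℝ => -x) ⁻¹' planeWedge) = volume (S ∩ planeWedge) := by
    have : S ∩ (fun x : ℝ × ℝ => -x) ⁻¹' planeWedge = (fun x : ℝ × ℝ => -x) ⁻¹' (S ∩ planeWedge) := by
      rw [preimage_inter, hneg]
    rw [this, volume_preimage_neg_plane]
  -- the third and fourth wedges
  have hnegS' : (fun x : ℝ × ℝ => -x) ⁻¹' (Prod.swap ⁻¹' S) = Prod.swap ⁻¹' S := by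
    ext x
    have := Set.ext_iff.1 hneg (Prod.swap x)
    simp only [mem_preimage] at this ⊢
    rw [← this]
    rfl
  have h3 : volume (S ∩ Prod.swap ⁻¹' (planeWedge ∪ (fun x : ℝ × ℝ => -x) ⁻¹' planeWedge)) =
      2 * volume (Prod.swap ⁻¹' S ∩ planeWedge) := by
    have hset : S ∩ Prod.swap ⁻¹' (planeWedge ∪ (fun x : ℝ × ℝ => -x) ⁻¹' planeWedge) =
        Prod.swap ⁻¹' ((Prod.swap ⁻¹' S ∩ planeWedge) ∪
          (Prod.swap ⁻¹' S ∩ (fun x : ℝ × ℝ => -x) ⁻¹' planeWedge)) := by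
      ext x
      simp only [mem_inter_iff, mem_preimage, mem_union, Prod.swap_swap]
      tauto
    have hdisj : Disjoint (Prod.swap ⁻¹' S ∩ planeWedge)
        (Prod.swap ⁻¹' S ∩ (fun x : ℝ × ℝ => -x) ⁻¹' planeWedge) := by
      rw [Set.disjoint_left]
      rintro x ⟨-, h1⟩ ⟨-, h2⟩
      simp only [mem_preimage, planeWedge, mem_setOf_eq, Prod.fst_neg, Prod.snd_neg,
        abs_neg] at h1 h2
      have := abs_nonneg x.1
      linarith
    have hm : MeasurableSet (Prod.swap ⁻¹' S ∩ (fun x : ℝ × ℝ => -x) ⁻¹' planeWedge) :=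
      (hS.preimage measurable_swap).inter (hW.preimage measurable_neg)
    rw [hset, volume_preimage_swap_plane, measure_union hdisj hm]
    have : Prod.swap ⁻¹' S ∩ (fun x : ℝ × ℝ => -x) ⁻¹' planeWedge =
        (fun x : ℝ × ℝ => -x) ⁻¹' (Prod.swap ⁻¹' S ∩ planeWedge) := by
      rw [preimage_inter, hnegS']
    rw [this, volume_preimage_neg_plane, two_mul]
  rw [h2, h3]
  ring

/-! ### Sections of an even, radially monotone sublevel set with its translate -/

/-- For `g` even and monotone on `[0, ∞)`, `δ ≥ 0`:
`g (τ + δ/2) ≤ c ∧ g (τ − δ/2) ≤ c ↔ g (|τ| + δ/2) ≤ c`. [folklore] -/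
theorem le_and_le_iff_abs {g : ℝ → ℝ} (heven : ∀ x, g (-x) = g x) (hmono : MonotoneOn g (Ici 0))
    {δ : ℝ} (hδ : 0 ≤ δ) (c τ : ℝ) :
    g (τ + δ / 2) ≤ c ∧ g (τ - δ / 2) ≤ c ↔ g (|τ| + δ / 2) ≤ c := by
  have key : ∀ x : ℝ, g x = g |x| := by
    intro x
    rcases le_or_gt 0 x with h | h
    · rw [abs_of_nonneg h]
    · rw [abs_of_neg h, heven]
  have hmax : max |τ + δ / 2| |τ - δ / 2| = |τ| + δ / 2 := by
    rcases le_or_gt 0 τ with h | h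
    · rw [abs_of_nonneg h, max_eq_left]
      · rw [abs_of_nonneg (by linarith)]
      · rw [abs_of_nonneg (by linarith : (0 : ℝ) ≤ τ + δ / 2)]
        exact abs_le.2 ⟨by linarith, by linarith⟩
    · rw [abs_of_neg h, max_eq_right]
      · rw [abs_of_nonpos (by linarith)]
        ring_nf
      · rw [abs_of_nonpos (by linarith : τ - δ / 2 ≤ 0)]
        exact abs_le.2 ⟨by linarith, by linarith⟩
  rw [key (τ + δ / 2), key (τ - δ / 2), ← hmax]
  constructor
  · rintro ⟨h1, h2⟩
    rcases le_total |τ + δ / 2| |τ - δ / 2| with h | h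
    · rwa [max_eq_right h]
    · rwa [max_eq_left h]
  · intro h
    have hm : max |τ + δ / 2| |τ - δ / 2| ∈ Ici (0 : ℝ) :=
      mem_Ici.2 (le_trans (abs_nonneg _) (le_max_left _ _))
    have ha : |τ + δ / 2| ∈ Ici (0 : ℝ) := mem_Ici.2 (abs_nonneg _)
    have hb : |τ - δ / 2| ∈ Ici (0 : ℝ) := mem_Ici.2 (abs_nonneg _)
    exact ⟨(hmono ha hm (le_max_left _ _)).trans h, (hmono hb hm (le_max_right _ _)).trans h⟩

/-- Lebesgue measure on `ℝ` is invariant under `x ↦ −x`. [folklore] -/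
theorem volume_preimage_neg_real (A : Set ℝ) : volume ((fun x : ℝ => -x) ⁻¹' A) = volume A := by
  have h := Real.volume_preimage_mul_left (a := (-1 : ℝ)) (by norm_num) A
  simp only [neg_mul, one_mul, inv_neg, inv_one, abs_neg, abs_one, ENNReal.ofReal_one,
    one_mul] at h
  exact h

/-- **The section lemma**: for `g` even and monotone on `[0, ∞)` and `δ ≥ 0`,
`λ₁{τ | g τ ≤ c ∧ g (τ − δ) ≤ c} = 2 λ₁((δ/2, ∞) ∩ {t | g t ≤ c})`.
[cite: LovasAndai2017, Appendix A (the reduction to |t| > δ/2)] -/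
theorem volume_setOf_le_and_le_sub {g : ℝ → ℝ} (heven : ∀ x, g (-x) = g x)
    (hmono : MonotoneOn g (Ici 0)) (c : ℝ) (hmeas : MeasurableSet {t | g t ≤ c}) {δ : ℝ}
    (hδ : 0 ≤ δ) :
    volume {τ | g τ ≤ c ∧ g (τ - δ) ≤ c} = 2 * volume (Ioi (δ / 2) ∩ {t | g t ≤ c}) := by
  -- translate by `δ/2`
  have h1 : {τ | g τ ≤ c ∧ g (τ - δ) ≤ c} =
      (fun τ => τ + -(δ / 2)) ⁻¹' {τ | g (τ + δ / 2) ≤ c ∧ g (τ - δ / 2) ≤ c} := by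
    ext τ
    simp only [mem_setOf_eq, mem_preimage]
    have e1 : τ + -(δ / 2) + δ / 2 = τ := by ring
    have e2 : τ + -(δ / 2) - δ / 2 = τ - δ := by ring
    rw [e1, e2]
  rw [h1, measure_preimage_add_right]
  -- the symmetric description
  have h2 : {τ | g (τ + δ / 2) ≤ c ∧ g (τ - δ / 2) ≤ c} = {τ | g (|τ| + δ / 2) ≤ c} := by
    ext τ
    exact le_and_le_iff_abs heven hmono hδ c τ
  rw [h2]
  -- split at `0`
  have hA : MeasurableSet {τ : ℝ | g (|τ| + δ / 2) ≤ c} :=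
    hmeas.preimage (show Measurable (fun τ : ℝ => |τ| + δ / 2) by fun_prop)
  have hpos : {τ : ℝ | g (|τ| + δ / 2) ≤ c} ∩ Ioi 0 =
      (fun τ => τ + δ / 2) ⁻¹' (Ioi (δ / 2) ∩ {t | g t ≤ c}) := by
    ext τ
    simp only [mem_inter_iff, mem_setOf_eq, mem_Ioi, mem_preimage]
    constructor
    · rintro ⟨h, hτ⟩
      refine ⟨by linarith, ?_⟩
      rwa [abs_of_pos hτ] at h
    · rintro ⟨hτ, h⟩
      have hτ0 : 0 < τ := by linarith
      refine ⟨?_, hτ0⟩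
      rwa [abs_of_pos hτ0]
  have hnegA : {τ : ℝ | g (|τ| + δ / 2) ≤ c} ∩ Iio 0 =
      (fun τ : ℝ => -τ) ⁻¹' ({τ : ℝ | g (|τ| + δ / 2) ≤ c} ∩ Ioi 0) := by
    ext τ
    simp only [mem_inter_iff, mem_setOf_eq, mem_Iio, mem_preimage, mem_Ioi, abs_neg, neg_pos]
  have hsplit : volume {τ : ℝ | g (|τ| + δ / 2) ≤ c} =
      volume ({τ : ℝ | g (|τ| + δ / 2) ≤ c} ∩ Iio 0) +
        volume ({τ : ℝ | g (|τ| + δ / 2) ≤ c} ∩ Ioi 0) := by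
    have e := measure_inter_add_sdiff (μ := (volume : Measure ℝ)) {τ : ℝ | g (|τ| + δ / 2) ≤ c}
      (measurableSet_Iio (a := (0:ℝ)))
    rw [← e]
    congr 1
    apply measure_congr
    have : {τ : ℝ | g (|τ| + δ / 2) ≤ c} \ Iio 0 =
        ({τ : ℝ | g (|τ| + δ / 2) ≤ c} ∩ Ioi 0) ∪ ({τ : ℝ | g (|τ| + δ / 2) ≤ c} ∩ {0}) := by
      ext τ
      simp only [mem_sdiff, mem_setOf_eq, mem_Iio, not_lt, mem_union, mem_inter_iff, mem_Ioi,
        mem_singleton_iff]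
      constructor
      · rintro ⟨h, hτ⟩
        rcases hτ.lt_or_eq with hτ | hτ
        · exact Or.inl ⟨h, hτ⟩
        · exact Or.inr ⟨h, hτ.symm⟩
      · rintro (⟨h, hτ⟩ | ⟨h, hτ⟩)
        · exact ⟨h, hτ.le⟩
        · exact ⟨h, hτ.ge⟩
    rw [this]
    refine (union_ae_eq_left_of_ae_eq_empty ?_)
    exact (ae_eq_empty.2 (measure_mono_null inter_subset_right (measure_singleton 0)))
  rw [hsplit, hnegA, volume_preimage_neg_real, hpos, measure_preimage_add_right, two_mul]

end Literature.InformationTheory.Entanglement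

end
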